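import Literature.Computability.Cryptography.LiuPassLemma53Defs
import HarnessLib

/-!
# Liu–Pass Lemma 5.3: the hashed function `g` is `𝒮`-hiding (Claim in the Appendix)

Fifth level of the decomposition of `condEPPRG_of_OWFExist` (Liu–Pass, FOCS 2020, Thm 5.5): the
**hiding claim** of the printed proof of Lemma 5.3 (arXiv:2009.11514, Appendix, Claim "The
function `f̂(·,·)` is `𝒮`-hiding"), for the construction `L53Params.g` of
`LiuPassLemma53Defs.lean`:

  `IsSOWF f S`, `f` regular over `S` with regularity `r`, `S` saturated  ⟹  `IsHidingOver (g r) S m`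

(`isHidingOver_g`), modulo the efficiency of the printed inverter (`hidRun_polyTime`, a named fact
in the style of the tree's other TM2 efficiency facts, to be discharged with the `FP` toolkit).

Printed proof: from a PPT `𝒜` finding `x` from `σ₁ ‖ σ₂ ‖ [h_{σ₁}(x)]_a ‖ [h_{σ₂}(f x)]_b` with
probability `ε(n)`, the inverter `𝒜'(1ⁿ, y)` samples `σ₁, σ₂`, **guesses** the `a` hash bits of `x`,
and runs `𝒜`; it outputs `x` itself with probability `2^{-a} ε`, and — since `x ← S_n` is uniform
on its fibre, of size `≥ 2^{r(n)-1}` — inverts `f` with probability `≥ 2^{r(n)-1} 2^{-a} ε ≥ ε/2`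
(`a ≤ r(n)`), contradicting `𝒮`-one-wayness.

## Rendering

* **Saturation.** The regain factor `2^{r(n)-1}` needs the fibre of `x` *inside* `S_n` to have that
  size; the tree's `IsRegularOver` counts preimages in `{0,1}ⁿ` (print: `f : S_n → {0,1}^*`, so
  its fibres are automatically inside `S_n`). We therefore assume `S` **saturated**
  (`IsSaturated f S`: `S_n` is a union of fibres of `f`), which holds for the sets `lpRegSet f` of
  Lemma 5.4 where Lemma 5.3 is applied.
* **The index is advice.** Print's `𝒜'` uses `r(n)`, which is not computable from `n`; as in
  `LiuPassCondFromRegular.lean`/`YaoAmplification.lean`, the pair `(r(n), κ)` (`κ` = `𝒜`'s coin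
  count) is carried by the *number of coins* of `𝒜'` (`Code`, decoded by `mod`/`div`, `hidRun_eq`),
  on a sparse set of good lengths selected with `Yao.seqN`/`Yao.sel` so that the input length
  `|⟨1ⁿ, f x⟩|` determines `n` (`cl`, `cl_eq`); "infinitely often" is all the contradiction needs.
* The probability bookkeeping is exact counting over the coin segments
  (`uniformAvg_add`/`uniformAvg_take`): `Pr_c[E_{x'}] = 2^{-a} p_{x'}` (`uniformAvg_event`), the
  events `E_{x'}` over the fibre are disjoint successes (`sum_indicator_le`), and the regain is the
  fibre sum (`sum_fibre_ge`).

## References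

* Y. Liu, R. Pass, *On one-way functions and Kolmogorov complexity*, FOCS 2020
  (arXiv:2009.11514), Appendix, Claim (`f̂` is `𝒮`-hiding) in the proof of Lemma 5.3.
* O. Goldreich, *Foundations of Cryptography I*, CUP 2001, §3.5.
-/

namespace Literature.Computability.Cryptography

open Finset Filter Asymptotics _root_.Computability Complexity AffineStr

/-- **Saturated domains**: `S_n` is a union of fibres of `f` (if `x ∈ S_n` and `f x' = f x` for
`x' ∈ {0,1}ⁿ` then `x' ∈ S_n`). True for the regular domains `lpRegSet f` of Liu–Pass's Lemma 5.4,
and implicit in print's Lemma 5.3, where `f : S_n → {0,1}^*`. [Y. Liu, R. Pass, FOCS 2020, §5.3]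
[folklore] -/
def IsSaturated (f : List Bool → List Bool) (S : ∀ n : ℕ, Finset (List.Vector Bool n)) : Prop :=
  ∀ (n : ℕ) (x x' : List.Vector Bool n), x ∈ S n → f x'.toList = f x.toList → x' ∈ S n

/-! ### Uniform averages: linearity and monotonicity -/

/-- Monotonicity of the uniform average. [folklore] -/
theorem uniformAvg_mono {k : ℕ} {f g : List Bool → ℝ} (h : ∀ x : List Bool, x.length = k → f x ≤ g x) :
    uniformAvg k f ≤ uniformAvg k g := by
  unfold uniformAvg
  exact div_le_div_of_nonneg_right (Finset.sum_le_sum fun x _ => h _ (by simp)) (by positivity)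

/-- Constants come out of the uniform average. [folklore] -/
theorem uniformAvg_const_mul {k : ℕ} (c : ℝ) (f : List Bool → ℝ) : uniformAvg k (fun x => c * f x) = c * uniformAvg k f := by
  unfold uniformAvg
  rw [← Finset.mul_sum, mul_div_assoc]

/-- Constants come out of the uniform average (right). [folklore] -/
theorem uniformAvg_mul_const {k : ℕ} (c : ℝ) (f : List Bool → ℝ) : uniformAvg k (fun x => f x * c) = uniformAvg k f * c := by
  rw [mul_comm, ← uniformAvg_const_mul]; simp_rw [mul_comm]

/-- Finite sums come out of the uniform average. [folklore] -/
theorem uniformAvg_finset_sum {ι : Type*} {k : ℕ} (T : Finset ι) (f : ι → List Bool → ℝ) :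
    uniformAvg k (fun x => ∑ i ∈ T, f i x) = ∑ i ∈ T, uniformAvg k (f i) := by
  unfold uniformAvg
  rw [Finset.sum_comm, Finset.sum_div]

/-- A `RandAlg` event probability as the uniform average of the indicator over the coins
(any output type). [Arora–Barak 2009, §7.1] [folklore] -/
theorem _root_.Literature.Computability.Complexity.RandAlg.pr_eq_uniformAvg {α β : Type} (A : RandAlg α β) (ea : α → List Bool)
    (x : α) (E : Set β) [DecidablePred (· ∈ E)] {κ : ℕ} (hκ : A.coinLen (ea x).length = κ) :
    A.pr ea x E = uniformAvg κ fun r => if A.run x r ∈ E then 1 else 0 := by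
  classical
  rw [A.pr_eq_card_filter_div ea x E hκ, uniformAvg]
  congr 1
  rw [Finset.natCast_card_filter]

/-- The fraction of `n`-bit strings with a prescribed `a`-bit prefix is `2^{-a}`. [folklore] -/
theorem uniformAvg_take_eq {n a : ℕ} (ha : a ≤ n) {h : List Bool} (hh : h.length = a) :
    uniformAvg n (fun z => if z.take a = h then (1 : ℝ) else 0) = ((2 : ℝ) ^ a)⁻¹ := by
  classical
  obtain ⟨e, rfl⟩ : ∃ e, n = a + e := ⟨n - a, by omega⟩
  rw [uniformAvg_add a e (fun u _ => if u = h then (1 : ℝ) else 0)]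
  simp only [uniformAvg_const]
  unfold uniformAvg
  rw [Finset.sum_boole]
  have : (Finset.univ.filter fun x : List.Vector Bool a => x.toList = h) = {⟨h, hh⟩} := by
    ext x
    simp only [Finset.mem_filter, Finset.mem_univ, true_and, Finset.mem_singleton]
    constructor
    · intro hx; exact List.Vector.toList_injective hx
    · rintro rfl; rfl
  rw [this, Finset.card_singleton, Nat.cast_one, one_div]

namespace L53Params

variable (Q : L53Params)

/-! ### The inverter `𝒜'` -/

/-- The input length of `𝒜` in the hiding game: `|⟨1ⁿ, g(x ‖ ρ)⟩| = 2n + 2 + (m + L)`. [folklore] -/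
def ℓA (n : ℕ) : ℕ := 2 * n + 2 + (Q.m n + Q.L n)

/-- Strict bound `K_b` on `𝒜`'s coin count at block length `n` (`q_𝒜` a bound on `𝒜.coinLen`). [folklore] -/
def KbH (qA : Polynomial ℕ) (n : ℕ) : ℕ := qA.eval (Q.ℓA n) + 1

/-- The modulus of the advice encoding: `(n + 2) · K_b` (indices `j ≤ n + 1`). [folklore] -/
def BaseH (qA : Polynomial ℕ) (n : ℕ) : ℕ := (n + 2) * Q.KbH qA n

/-- **The printed inverter `𝒜'`, run function**: on `⟨1ⁿ, y⟩` with coins `c`, decode the advice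
`(j, κ)` from `|c|`, let `ρ = c ↾ m`, guess the `a = min j L` hash bits `z` from the next `n`
coins, and run `𝒜` on `⟨1ⁿ, ρ ‖ z ‖ [h²_{R₂}(pad y)]_b⟩` with the next `κ` coins. [Y. Liu, R. Pass,
FOCS 2020, Appendix (proof of the Claim: "`𝒜'(1ⁿ, y)` samples `σ₁, σ₂` and a guess `z` …")]
[folklore] -/
def hidRun (A : RandAlg (List Bool) (List Bool)) (qA : Polynomial ℕ) (inp coins : List Bool) : List Bool :=
  A.run (boolPair (unaryEncodeNat (boolUnpair inp).1.length)
      (coins.take (Q.m (boolUnpair inp).1.length) ++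
        ((coins.drop (Q.m (boolUnpair inp).1.length)).take (boolUnpair inp).1.length).take
          (Q.aOf (coins.length % Q.BaseH qA (boolUnpair inp).1.length / Q.KbH qA (boolUnpair inp).1.length)
            (boolUnpair inp).1.length) ++
        hashStr (Q.M (boolUnpair inp).1.length)
          (Q.bOf (coins.length % Q.BaseH qA (boolUnpair inp).1.length / Q.KbH qA (boolUnpair inp).1.length)
            (boolUnpair inp).1.length)
          (((coins.take (Q.m (boolUnpair inp).1.length)).drop (R₁ (boolUnpair inp).1.length)).take
            (Q.R₂ (boolUnpair inp).1.length))
          (Q.pad (boolUnpair inp).1.length (boolUnpair inp).2)))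
    ((coins.drop (Q.m (boolUnpair inp).1.length + (boolUnpair inp).1.length)).take
      (coins.length % Q.BaseH qA (boolUnpair inp).1.length % Q.KbH qA (boolUnpair inp).1.length))

/-- `𝒜'` as a randomized algorithm with coin budget `cl`. [folklore] -/
def hidRed (A : RandAlg (List Bool) (List Bool)) (qA : Polynomial ℕ) (cl : ℕ → ℕ) : RandAlg (List Bool) (List Bool) where
  run := Q.hidRun A qA
  coinLen := cl

/-- **Efficiency of the printed inverter** (named fact, D-0014): for a PPT `𝒜` and polynomial-time
`f`, the run function `hidRun` — unary parsing, `mod`/`div` decoding of the advice from the coin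
count, `take`/`drop`, the padding of `y`, one affine hash (`AffineProg.hashFn`) and one call of
`𝒜` — is polynomial time on the pair presentation of (input, coins). To be discharged with the
`FP` toolkit. [Y. Liu, R. Pass, FOCS 2020, Appendix (the Claim: "Consider the PPT `𝒜'` …")]
[cite: LiuPassFOCS2020, Lemma 5.3 (proof, Appendix: Claim, the PPT A')] -/
def hidRun_polyTime : Prop :=
  ∀ (Q : L53Params) (A : RandAlg (List Bool) (List Bool)) (qA : Polynomial ℕ), IsPPT A id → PolyTimeComputable id id Q.f →
    PolyTimeComputable (fun p : List Bool × List Bool => boolPair p.1 p.2) id (Function.uncurry (Q.hidRun A qA))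

variable {Q}

/-- **Decoding the advice**: with `|c| = j·K_b + κ + Base·W`, `κ < K_b`, `j ≤ n + 1`, the run of
`𝒜'` on `⟨1ⁿ, y⟩` is `𝒜(1ⁿ, ρ ‖ z ‖ h²(pad y); c_𝒜)`. [folklore] -/
theorem hidRun_eq {A : RandAlg (List Bool) (List Bool)} {qA : Polynomial ℕ} {n j κ W : ℕ} (hκ : κ < Q.KbH qA n) (hj : j ≤ n + 1)
    (y c : List Bool) (hc : c.length = j * Q.KbH qA n + κ + Q.BaseH qA n * W) :
    Q.hidRun A qA (boolPair (unaryEncodeNat n) y) c =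
      A.run (boolPair (unaryEncodeNat n)
        (c.take (Q.m n) ++ ((c.drop (Q.m n)).take n).take (Q.aOf j n) ++
          hashStr (Q.M n) (Q.bOf j n) (((c.take (Q.m n)).drop (R₁ n)).take (Q.R₂ n)) (Q.pad n y)))
        ((c.drop (Q.m n + n)).take κ) := by
  have hK : 0 < Q.KbH qA n := Nat.succ_pos _
  have hadv : c.length % Q.BaseH qA n = j * Q.KbH qA n + κ := by
    rw [hc, Nat.add_mul_mod_self_left, Nat.mod_eq_of_lt]
    unfold BaseH
    calc j * Q.KbH qA n + κ < j * Q.KbH qA n + Q.KbH qA n := by omega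
      _ = (j + 1) * Q.KbH qA n := by ring
      _ ≤ (n + 2) * Q.KbH qA n := Nat.mul_le_mul_right _ (by omega)
  have h1 : (j * Q.KbH qA n + κ) / Q.KbH qA n = j := by
    rw [Nat.add_comm, Nat.add_mul_div_right _ _ hK, Nat.div_eq_of_lt hκ, Nat.zero_add]
  have h2 : (j * Q.KbH qA n + κ) % Q.KbH qA n = κ := by
    rw [Nat.add_comm, Nat.add_mul_mod_self_right, Nat.mod_eq_of_lt hκ]
  have hn : (unaryEncodeNat n).length = n := unary_decode_encode_nat n
  simp only [hidRun, boolUnpair_boolPair, hn, hadv, h1, h2]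

/-! ### The probability analysis at one block length -/

section Analysis

variable {A : RandAlg (List Bool) (List Bool)} {qA : Polynomial ℕ} {cl : ℕ → ℕ} {r : ℕ → ℕ} {n κ W : ℕ}

/-- `p_{x'} = E_ρ Pr[𝒜(1ⁿ, g(x' ‖ ρ)) = x']`. [folklore] -/
noncomputable def pHit (Q : L53Params) (A : RandAlg (List Bool) (List Bool)) (r : ℕ → ℕ) (n : ℕ) (x' : List.Vector Bool n) : ℝ :=
  uniformAvg (Q.m n) fun ρ => A.pr id (boolPair (unaryEncodeNat n) (Q.gcore n (r n) x'.toList ρ)) {z | z = x'.toList}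

/-- The success event of `𝒜'` attached to the fibre element `x'`: the guess hits `x'`'s hash and
`𝒜` answers `x'`. [folklore] -/
def hitEv (Q : L53Params) (A : RandAlg (List Bool) (List Bool)) (r : ℕ → ℕ) (n κ : ℕ) (x' : List.Vector Bool n) (c : List Bool) : Prop :=
  ((c.drop (Q.m n)).take n).take (Q.aOf (r n) n) = hashStr n (Q.aOf (r n) n) ((c.take (Q.m n)).take (R₁ n)) x'.toList ∧
    A.run (boolPair (unaryEncodeNat n) (Q.gcore n (r n) x'.toList (c.take (Q.m n)))) ((c.drop (Q.m n + n)).take κ) = x'.toList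

/-- `hitEv` is decidable. [folklore] -/
instance (Q : L53Params) (A : RandAlg (List Bool) (List Bool)) (r : ℕ → ℕ) (n κ : ℕ) (x' : List.Vector Bool n) (c : List Bool) :
    Decidable (hitEv Q A r n κ x' c) := by unfold hitEv; infer_instance

/-- `𝒜`'s input in the hiding game has length `ℓ_𝒜(n)`. [folklore] -/
theorem length_query (x' : List.Vector Bool n) {ρ : List Bool} (hρ : ρ.length = Q.m n) :
    (boolPair (unaryEncodeNat n) (Q.gcore n (r n) x'.toList ρ)).length = Q.ℓA n := by
  rw [length_boolPair, show (unaryEncodeNat n).length = n from unary_decode_encode_nat n, Q.length_gcore, hρ, ℓA]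

/-- **`Pr_c[E_{x'}] = 2^{-a} · p_{x'}`** over coins of length `m + (n + (κ + W))`, `κ = 𝒜`'s coin
count at input length `ℓ_𝒜(n)`, `a ≤ n`. [Y. Liu, R. Pass, FOCS 2020, Appendix ("the guess is
correct with probability `2^{-(r(n) - α' log n)}`")] [folklore] -/
theorem uniformAvg_event (x' : List.Vector Bool n) (hκA : A.coinLen (Q.ℓA n) = κ) (ha : Q.aOf (r n) n ≤ n) :
    uniformAvg (Q.m n + (n + (κ + W))) (fun c => if hitEv Q A r n κ x' c then (1 : ℝ) else 0) =
      ((2 : ℝ) ^ Q.aOf (r n) n)⁻¹ * pHit Q A r n x' := by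
  classical
  set a := Q.aOf (r n) n with ha'
  -- split off `ρ`
  have step1 := uniformAvg_add (Q.m n) (n + (κ + W)) (fun ρ t =>
    if (t.take n).take a = hashStr n a (ρ.take (R₁ n)) x'.toList ∧
        A.run (boolPair (unaryEncodeNat n) (Q.gcore n (r n) x'.toList ρ)) ((t.drop n).take κ) = x'.toList then (1 : ℝ) else 0)
  have hrw : (fun c : List Bool => if hitEv Q A r n κ x' c then (1 : ℝ) else 0) = fun c =>
      (fun ρ t => if (t.take n).take a = hashStr n a (ρ.take (R₁ n)) x'.toList ∧
        A.run (boolPair (unaryEncodeNat n) (Q.gcore n (r n) x'.toList ρ)) ((t.drop n).take κ) = x'.toList then (1 : ℝ) else 0)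
        (c.take (Q.m n)) (c.drop (Q.m n)) := by
    funext c
    refine if_congr ?_ rfl rfl
    rw [hitEv, ha', List.drop_drop]
  rw [hrw, step1, pHit, ← uniformAvg_const_mul]
  refine uniformAvg_congr fun ρ hρ => ?_
  -- split `t = z ‖ u`; the indicator factors
  have step2 := uniformAvg_add n (κ + W) (fun z u =>
    (if z.take a = hashStr n a (ρ.take (R₁ n)) x'.toList then (1 : ℝ) else 0) *
      (if A.run (boolPair (unaryEncodeNat n) (Q.gcore n (r n) x'.toList ρ)) (u.take κ) = x'.toList then (1 : ℝ) else 0))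
  have hrw2 : (fun t : List Bool => if (t.take n).take a = hashStr n a (ρ.take (R₁ n)) x'.toList ∧
      A.run (boolPair (unaryEncodeNat n) (Q.gcore n (r n) x'.toList ρ)) ((t.drop n).take κ) = x'.toList then (1 : ℝ) else 0) =
      fun t => (fun z u => (if z.take a = hashStr n a (ρ.take (R₁ n)) x'.toList then (1 : ℝ) else 0) *
        (if A.run (boolPair (unaryEncodeNat n) (Q.gcore n (r n) x'.toList ρ)) (u.take κ) = x'.toList then (1 : ℝ) else 0))
        (t.take n) (t.drop n) := by
    funext t
    by_cases h1 : (t.take n).take a = hashStr n a (ρ.take (R₁ n)) x'.toList <;>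
      by_cases h2 : A.run (boolPair (unaryEncodeNat n) (Q.gcore n (r n) x'.toList ρ)) ((t.drop n).take κ) = x'.toList <;>
      simp [h1, h2]
  rw [hrw2, step2]
  simp only [uniformAvg_const_mul]
  have hlen : A.coinLen (id (boolPair (unaryEncodeNat n) (Q.gcore n (r n) x'.toList ρ))).length = κ := by
    rw [← hκA, ← length_query (r := r) x' hρ]; rfl
  rw [uniformAvg_mul_const, uniformAvg_take_eq ha (length_hashStr _ _ _ _),
    uniformAvg_take κ W (fun u => if A.run (boolPair (unaryEncodeNat n) (Q.gcore n (r n) x'.toList ρ)) u = x'.toList then (1 : ℝ) else 0),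
    A.pr_eq_uniformAvg id _ {z | z = x'.toList} hlen]
  rfl

/-- **A hit on a fibre element inverts, and hits are unique**: for `y = f x'` the event `E_{x'}`
forces `𝒜'(1ⁿ, y; c) = x'`. [Y. Liu, R. Pass, FOCS 2020, Appendix (proof of the Claim)] [folklore] -/
theorem hidRun_eq_of_hitEv (hκ : κ < Q.KbH qA n) (hj : r n ≤ n + 1) {x' : List.Vector Bool n} {y c : List Bool}
    (hc : c.length = r n * Q.KbH qA n + κ + Q.BaseH qA n * W) (hy : Q.f x'.toList = y) (hE : hitEv Q A r n κ x' c) :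
    Q.hidRun A qA (boolPair (unaryEncodeNat n) y) c = x'.toList := by
  obtain ⟨hz, hA⟩ := hE
  rw [hidRun_eq hκ hj y c hc, hz, ← hy]
  simpa only [gcore, List.append_assoc] using hA

/-- **Disjoint successes**: over the fibre of `x`, at most one `E_{x'}` holds, and if one does then
`𝒜'` inverts. [folklore] -/
theorem sum_indicator_le (hκ : κ < Q.KbH qA n) (hj : r n ≤ n + 1) (x : List.Vector Bool n) {c : List Bool}
    (hc : c.length = r n * Q.KbH qA n + κ + Q.BaseH qA n * W) :
    (∑ x' ∈ Finset.univ.filter (fun x' : List.Vector Bool n => Q.f x'.toList = Q.f x.toList),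
        (if hitEv Q A r n κ x' c then (1 : ℝ) else 0)) ≤
      if Q.hidRun A qA (boolPair (unaryEncodeNat n) (Q.f x.toList)) c ∈ {z | Q.f z = Q.f x.toList} then 1 else 0 := by
  classical
  rw [Finset.sum_boole]
  set T := (Finset.univ.filter (fun x' : List.Vector Bool n => Q.f x'.toList = Q.f x.toList)).filter (fun x' => hitEv Q A r n κ x' c)
    with hT
  have hT1 : T.card ≤ 1 := by
    refine Finset.card_le_one.2 fun x₁ h₁ x₂ h₂ => ?_
    rw [hT, Finset.mem_filter, Finset.mem_filter] at h₁ h₂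
    have e₁ := hidRun_eq_of_hitEv hκ hj hc h₁.1.2 h₁.2
    have e₂ := hidRun_eq_of_hitEv hκ hj hc h₂.1.2 h₂.2
    exact List.Vector.toList_injective (e₁.symm.trans e₂)
  rcases Nat.eq_zero_or_pos T.card with h0 | hpos
  · rw [h0, Nat.cast_zero]; split_ifs <;> norm_num
  · have h1 : T.card = 1 := le_antisymm hT1 hpos
    obtain ⟨x₀, hx₀⟩ := Finset.card_pos.1 hpos
    rw [hT, Finset.mem_filter, Finset.mem_filter] at hx₀
    have e := hidRun_eq_of_hitEv hκ hj hc hx₀.1.2 hx₀.2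
    rw [h1, Nat.cast_one, if_pos (by rw [e]; exact hx₀.1.2)]

/-- **The fibre sum (the regain `2^{r(n)-1}`)**: on a saturated `S` with fibres of size
`≥ 2^{r(n)-1}`, `Σ_{x ∈ S} Σ_{x' ∈ fibre x} p_{x'} ≥ 2^{r(n)-1} Σ_{x' ∈ S} p_{x'}`.
[Y. Liu, R. Pass, FOCS 2020, Appendix ("since any `y ∈ f(S_n)` has at least `2^{r(n)-1}`
pre-images")] [folklore] -/
theorem sum_fibre_ge {S : ∀ n : ℕ, Finset (List.Vector Bool n)} (hsat : IsSaturated Q.f S)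
    (hreg : ∀ x ∈ S n, 2 ^ (r n - 1) ≤ preimCard Q.f n x.toList) (p : List.Vector Bool n → ℝ) (hp : ∀ x', 0 ≤ p x') :
    (2 : ℝ) ^ (r n - 1) * ∑ x' ∈ S n, p x' ≤
      ∑ x ∈ S n, ∑ x' ∈ Finset.univ.filter (fun x' : List.Vector Bool n => Q.f x'.toList = Q.f x.toList), p x' := by
  classical
  -- swap the sums: `Σ_x Σ_{x' ∈ fibre x} p x' = Σ_{x'} p x' · #{x ∈ S : f x = f x'}`
  have hswap : (∑ x ∈ S n, ∑ x' ∈ Finset.univ.filter (fun x' : List.Vector Bool n => Q.f x'.toList = Q.f x.toList), p x') =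
      ∑ x' : List.Vector Bool n, p x' * ((S n).filter fun x => Q.f x.toList = Q.f x'.toList).card := by
    simp_rw [Finset.sum_filter]
    rw [Finset.sum_comm]
    refine Finset.sum_congr rfl fun x' _ => ?_
    have hF : ((S n).filter fun x => Q.f x'.toList = Q.f x.toList) = (S n).filter fun x => Q.f x.toList = Q.f x'.toList :=
      Finset.filter_congr fun x _ => eq_comm
    rw [← Finset.sum_filter, Finset.sum_const, nsmul_eq_mul, mul_comm, hF]
  rw [hswap, Finset.mul_sum]
  -- drop the terms outside `S` and use the fibre bound inside
  calc ∑ x' ∈ S n, (2 : ℝ) ^ (r n - 1) * p x'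
      ≤ ∑ x' ∈ S n, p x' * ((S n).filter fun x => Q.f x.toList = Q.f x'.toList).card := by
        refine Finset.sum_le_sum fun x' hx' => ?_
        rw [mul_comm]
        refine mul_le_mul_of_nonneg_left ?_ (hp x')
        have hfib : preimCard Q.f n x'.toList ≤ ((S n).filter fun x => Q.f x.toList = Q.f x'.toList).card := by
          unfold preimCard
          refine Finset.card_le_card fun x hx => ?_
          simp only [Finset.mem_filter, Finset.mem_univ, true_and] at hx ⊢
          exact ⟨hsat n x' x hx' hx, hx⟩
        exact_mod_cast (hreg x' hx').trans hfib
    _ ≤ ∑ x' : List.Vector Bool n, p x' * ((S n).filter fun x => Q.f x.toList = Q.f x'.toList).card :=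
        Finset.sum_le_sum_of_subset_of_nonneg (Finset.subset_univ _) fun x' _ _ => mul_nonneg (hp x') (Nat.cast_nonneg _)

/-- `g r (x ‖ ρ) = gcore n (r n) x ρ` for `|x| = n ≥ γ'`, `|ρ| = m(n)`. [folklore] -/
theorem g_append (hn : Q.γ' ≤ n) {x ρ : List Bool} (hx : x.length = n) (hρ : ρ.length = Q.m n) :
    Q.g r (x ++ ρ) = Q.gcore n (r n) x ρ := by
  have hG : Q.nOfG (x ++ ρ).length = n := by rw [List.length_append, hx, hρ, Q.nOfG_eq hn]
  simp only [g, hG]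
  rw [List.take_left' hx, List.drop_left' hx]

/-- `hidingProb` in terms of `pHit` for `n ≥ γ'` (`g r (x ‖ ρ) = gcore n (r n) x ρ`). [folklore] -/
theorem hidingProb_eq {S : ∀ n : ℕ, Finset (List.Vector Bool n)} (hn : Q.γ' ≤ n) :
    hidingProb (Q.g r) A S Q.m n = (∑ x ∈ S n, pHit Q A r n x) / (S n).card := by
  unfold hidingProb pHit uniformAvg
  rw [Finset.sum_div, Finset.sum_div]
  refine Finset.sum_congr rfl fun x _ => ?_
  rw [div_div]
  congr 1
  · refine Finset.sum_congr rfl fun ρ _ => ?_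
    rw [g_append hn (List.Vector.toList_length x) (List.Vector.toList_length ρ)]
  · exact mul_comm _ _

/-- **The printed inequality, counting form**: at a block length `n ≥ γ'` where the coin budget of
`𝒜'` is `r(n)·K_b + κ + Base·W` on all inputs `⟨1ⁿ, f x⟩`, `x ∈ S_n`, and `r(n) ≤ n + 1`,
`Pr_{x ← S_n}[𝒜' inverts f] ≥ ½ · hidingProb(g, 𝒜, n)`. [Y. Liu, R. Pass, FOCS 2020, Appendix
(proof of the Claim: "`≥ 2^{-r(n)+1} × Pr[𝒜' = x] ≥ 1/2p(n)`")] [folklore] -/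
theorem sInvertProb_ge {S : ∀ n : ℕ, Finset (List.Vector Bool n)} (hsat : IsSaturated Q.f S) (hn : Q.γ' ≤ n)
    (hregL : ∀ x ∈ S n, 2 ^ (r n - 1) ≤ preimCard Q.f n x.toList) (hj : r n ≤ n + 1) (hκ : κ < Q.KbH qA n)
    (hκA : A.coinLen (Q.ℓA n) = κ)
    (hcl : ∀ x ∈ S n, cl (boolPair (unaryEncodeNat n) (Q.f x.toList)).length = r n * Q.KbH qA n + κ + Q.BaseH qA n * W)
    (hW : Q.m n + n + κ ≤ r n * Q.KbH qA n + κ + Q.BaseH qA n * W) :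
    2⁻¹ * hidingProb (Q.g r) A S Q.m n ≤ sInvertProb Q.f (Q.hidRed A qA cl) S n := by
  classical
  rcases (S n).eq_empty_or_nonempty with h0 | hS
  · simp [hidingProb, sInvertProb, h0]
  have hSc : (0 : ℝ) < (S n).card := by exact_mod_cast hS.card_pos
  set C := r n * Q.KbH qA n + κ + Q.BaseH qA n * W with hC
  obtain ⟨W', hW'⟩ : ∃ W', C = Q.m n + (n + (κ + W')) := ⟨C - (Q.m n + n + κ), by omega⟩
  have ha : Q.aOf (r n) n ≤ n := (min_le_right _ _).trans (Q.L_le n)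
  have har : Q.aOf (r n) n ≤ r n := Q.aOf_le _ _
  -- per `x`: `Pr[𝒜' inverts at x] ≥ 2^{-a} Σ_{x' ∈ fibre x} p_{x'}`
  have hx : ∀ x ∈ S n, ((2 : ℝ) ^ Q.aOf (r n) n)⁻¹ *
      ∑ x' ∈ Finset.univ.filter (fun x' : List.Vector Bool n => Q.f x'.toList = Q.f x.toList), pHit Q A r n x' ≤
      (Q.hidRed A qA cl).pr id (boolPair (unaryEncodeNat n) (Q.f x.toList)) {z | Q.f z = Q.f x.toList} := by
    intro x hxS
    have hlen : (Q.hidRed A qA cl).coinLen (id (boolPair (unaryEncodeNat n) (Q.f x.toList))).length = Q.m n + (n + (κ + W')) :=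
      (hcl x hxS).trans hW'
    rw [(Q.hidRed A qA cl).pr_eq_uniformAvg id _ {z | Q.f z = Q.f x.toList} hlen, Finset.mul_sum]
    calc ∑ x' ∈ Finset.univ.filter (fun x' : List.Vector Bool n => Q.f x'.toList = Q.f x.toList), ((2 : ℝ) ^ Q.aOf (r n) n)⁻¹ * pHit Q A r n x'
        = ∑ x' ∈ Finset.univ.filter (fun x' : List.Vector Bool n => Q.f x'.toList = Q.f x.toList),
            uniformAvg (Q.m n + (n + (κ + W'))) (fun c => if hitEv Q A r n κ x' c then (1 : ℝ) else 0) :=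
          Finset.sum_congr rfl fun x' _ => (uniformAvg_event x' hκA ha).symm
      _ = uniformAvg (Q.m n + (n + (κ + W'))) (fun c => ∑ x' ∈ Finset.univ.filter (fun x' : List.Vector Bool n => Q.f x'.toList = Q.f x.toList),
            if hitEv Q A r n κ x' c then (1 : ℝ) else 0) := (uniformAvg_finset_sum _ _).symm
      _ ≤ _ := uniformAvg_mono fun c hc => sum_indicator_le hκ hj x (hc.trans hW'.symm)
  -- sum over `x ∈ S_n` and regain
  have hsum : ((2 : ℝ) ^ Q.aOf (r n) n)⁻¹ * ((2 : ℝ) ^ (r n - 1) * ∑ x' ∈ S n, pHit Q A r n x') ≤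
      ∑ x ∈ S n, (Q.hidRed A qA cl).pr id (boolPair (unaryEncodeNat n) (Q.f x.toList)) {z | Q.f z = Q.f x.toList} := by
    calc ((2 : ℝ) ^ Q.aOf (r n) n)⁻¹ * ((2 : ℝ) ^ (r n - 1) * ∑ x' ∈ S n, pHit Q A r n x')
        ≤ ((2 : ℝ) ^ Q.aOf (r n) n)⁻¹ * ∑ x ∈ S n, ∑ x' ∈ Finset.univ.filter (fun x' : List.Vector Bool n => Q.f x'.toList = Q.f x.toList),
            pHit Q A r n x' :=
          mul_le_mul_of_nonneg_left (sum_fibre_ge hsat hregL _ fun x' => uniformAvg_nonneg fun _ => A.pr_nonneg _ _ _) (by positivity)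
      _ = ∑ x ∈ S n, ((2 : ℝ) ^ Q.aOf (r n) n)⁻¹ * ∑ x' ∈ Finset.univ.filter (fun x' : List.Vector Bool n => Q.f x'.toList = Q.f x.toList),
            pHit Q A r n x' := by rw [Finset.mul_sum]
      _ ≤ _ := Finset.sum_le_sum hx
  -- `2^{-a} 2^{r-1} ≥ ½`
  have hhalf : (2⁻¹ : ℝ) ≤ ((2 : ℝ) ^ Q.aOf (r n) n)⁻¹ * (2 : ℝ) ^ (r n - 1) := by
    rw [← div_eq_inv_mul, le_div_iff₀ (by positivity)]
    rcases Nat.eq_zero_or_pos (r n) with h0 | hpos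
    · have : Q.aOf (r n) n = 0 := by have := har; omega
      rw [this, h0]; norm_num
    · calc (2⁻¹ : ℝ) * 2 ^ Q.aOf (r n) n ≤ 2⁻¹ * 2 ^ r n := by gcongr; norm_num
        _ = 2 ^ (r n - 1) := by
          obtain ⟨k, hk⟩ : ∃ k, r n = k + 1 := ⟨r n - 1, by omega⟩
          rw [hk, Nat.add_sub_cancel, pow_succ]; ring
  unfold sInvertProb
  rw [hidingProb_eq hn, ← mul_div_assoc, div_le_div_iff_of_pos_right hSc]
  have hsum0 : 0 ≤ ∑ x' ∈ S n, pHit Q A r n x' := Finset.sum_nonneg fun x' _ => uniformAvg_nonneg fun _ => A.pr_nonneg _ _ _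
  calc 2⁻¹ * ∑ x' ∈ S n, pHit Q A r n x' ≤ ((2 : ℝ) ^ Q.aOf (r n) n)⁻¹ * (2 : ℝ) ^ (r n - 1) * ∑ x' ∈ S n, pHit Q A r n x' :=
        mul_le_mul_of_nonneg_right hhalf hsum0
    _ = ((2 : ℝ) ^ Q.aOf (r n) n)⁻¹ * ((2 : ℝ) ^ (r n - 1) * ∑ x' ∈ S n, pHit Q A r n x') := by ring
    _ ≤ _ := hsum

end Analysis

end L53Params

end Literature.Computability.Cryptography
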